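import Summits.BirchSwinnertonDyer.Rank1Residual.X5.SelmerSolitaireExtend
import Summits.BirchSwinnertonDyer.Rank1Residual.X5.SelmerSolitairePivot
import Summits.BirchSwinnertonDyer.Rank1Residual.X5.SelmerSolitaireSchur
import HarnessLib

/-!
# X5 / O1 (p = 2), lens-2 "Selmer solitaire": the two MOVES of the one-prime connection theorem
# T4 (stub₂′) — fixing the last core condition by one adjacency, and the free `(0,0)` double step

HONEST FRAMING (cell `b2b-bsdres`, run/shared/lean/b2b/bsd-rank1-residual/, verbatim in every
file): the goal of the cell is to DELETE the COMBINATION-SHAPED residual classes of the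
Birch–Swinnerton-Dyer formula for ALL analytic-rank `≤ 1` elliptic curves over `ℚ` — assembled
STRICTLY from published theorems — so that the rank-`≤ 1` remainder becomes exactly the
CONSTRUCTION-SHAPED classes, which are TYPED (missing-input `Prop`s), NOT attempted. This is not
"finishing BSD". Cell O1 (`p = 2`): research route; O1 OPEN; nothing booked; no mark / label / count
moved. THEOREMS ONLY (no definition, no named fact, no `sorry`); pure `𝔽₂` linear algebra on lens-2's
normal form (x11b3-p4's vocabulary `X5/SelmerSolitaire.lean`, p272248, IMPORTED VERBATIM — nothing
re-declared); reach-neutral; nothing arithmetic is asserted.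

WHAT THIS FILE PROVES (o1 PROVER ORDER v2.8 (ii′); second hand x11b3-p2, split agreed with the
holder x11b3-p4). For a position `P`, the extension `extend P N` by a neighbourhood `N`
(`X5/SelmerSolitaireExtend.lean`) and the kernel-vector Schur lemmas (SC2)/(PEEL)
(`X5/SelmerSolitaireSchur.lean`):

* §1 `core_iff_det_ne_zero`; **`exists_erase_core_of_odd`** (an odd core `B` has `B ∖ b` core for
  some `b ∈ B` — PEEL at `∞`); **`exists_erase_erase_core_of_even`** (an even core `B`, `u ∈ B`:
  `B ∖ {u,v}` core for some `v` — PEEL at `u`). (lens-2 G5.3 Step 2, without inverses.)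
* §2 **`exists_update_core_withNew`** — move (i): if `b ∈ B` and `B ∖ b` is core then for every
  `N` some value `t` of the new prime's adjacency to `b` makes `B ∪ {q}` core in
  `extend P (N[b ↦ t])` ((SC2): the condition reads `N b + c = 1`, `c` blind to `N b`).
* §3 **`core_withNew_of_pair`** — move (ii), the `(0,0)` case of lens-2's Step 4 and the ONLY
  case the induction needs: `|B|` even, `u ≠ v ∈ B`, `B` and `B ∖ {u,v}` core, `B ∖ v` and `B ∖ u`
  NOT core ⟹ (`(B ∖ {u,v}) ∪ {q}` core ⟹ `B ∪ {q}` core) in `extend P N`, for EVERY `N`: the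
  solution `κ` of the column-`∞'` system on `X = oldV '' (B ∖ {u,v})⁺` also solves it on
  `X ∪ {oldV u, oldV v} = oldV '' B⁺`, so both conditions read `Ŝ'_{q∞'} + (Ŝ'κ)_q = 1`.

The induction over `|B|` and the theorems `exists_extend_chain` / `onePrimeConnection_strong` /
`onePrimeConnection_holds` are in `X5/SelmerSolitaireOnePrime.lean`. Plan verified exhaustively for
`s ≤ 4` before formalisation (`HOME/b2b-bsdres-x11b3-p2/o1/plan_check.py`; EVIDENCE only).

References: lens-2 GEN 5 addendum G5.2–G5.3, G5.10 (`HOME/b2b-bsdres-o1-idea-2-g5/`).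
-/

namespace Summit.BirchSwinnertonDyer.Rank1Residual.X5.SelmerSolitaire

open Finset Matrix

variable {s : ℕ}

/-! ### §1 Core sets read as nonsingular minors; peeling inside a position -/

/-- `Core P n ⟺ det Ŝ[n⁺] ≠ 0` (over `𝔽₂`, `= 1 ⟺ ≠ 0`). [folklore] -/
theorem core_iff_det_ne_zero (P : Position s) (n : Finset (Fin s)) :
    Core P n ↔ (P.S.submatrix (Subtype.val : ↥(plus n) → V s) Subtype.val).det ≠ 0 :=
  Alt.eq_one_iff_ne_zero _

/-- **An odd core `B` has a `b ∈ B` with `B ∖ b` core** (PEEL at `∞ ∈ B⁺`). [folklore] -/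
theorem exists_erase_core_of_odd (P : Position s) {B : Finset (Fin s)} (hB : Core P B)
    (hodd : ¬ Even B.card) : ∃ b ∈ B, Core P (B.erase b) := by
  have hdet := (core_iff_det_ne_zero P B).mp hB
  obtain ⟨v, hv, hvne, hv'⟩ := Alt.exists_erase_erase_det_ne_zero P.symm P.loopless hdet
    ((none_mem_plus_iff B).mpr hodd)
  obtain ⟨b, rfl⟩ := Option.ne_none_iff_exists'.mp hvne
  have hbB : b ∈ B := (some_mem_plus_iff B b).mp hv
  refine ⟨b, hbB, (core_iff_det_ne_zero P _).mpr ?_⟩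
  have hE : ((plus B).erase none).erase (some b) = plus (B.erase b) := by
    have h1 : Even (B.erase b).card := by
      rw [← Finset.card_erase_add_one hbB, Nat.even_add_one, not_not] at hodd
      exact hodd
    have hnot : (none : V s) ∉ B.map Function.Embedding.some := by simp
    rw [plus, if_neg hodd, plus, if_pos h1, Finset.erase_insert hnot, Finset.map_erase]
    rfl
  rw [← det_submatrix_congr P.S hE]
  exact hv'

/-- **An even core `B` and `u ∈ B`: some `v ∈ B`, `v ≠ u`, has `B ∖ {u,v}` core** (PEEL at `u`).
[folklore] -/
theorem exists_erase_erase_core_of_even (P : Position s) {B : Finset (Fin s)} (hB : Core P B)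
    (heven : Even B.card) {u : Fin s} (hu : u ∈ B) :
    ∃ v ∈ B, v ≠ u ∧ Core P ((B.erase u).erase v) := by
  have hdet := (core_iff_det_ne_zero P B).mp hB
  obtain ⟨v', hv', hvne, hv''⟩ := Alt.exists_erase_erase_det_ne_zero P.symm P.loopless hdet
    ((some_mem_plus_iff B u).mpr hu)
  have hplus : plus B = B.map Function.Embedding.some := if_pos heven
  obtain ⟨v, hvB, rfl⟩ : ∃ v ∈ B, (Function.Embedding.some v : V s) = v' := by
    rw [hplus, Finset.mem_map] at hv'
    exact hv'
  have hvu : v ≠ u := fun h => hvne (by rw [h]; rfl)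
  refine ⟨v, hvB, hvu, (core_iff_det_ne_zero P _).mpr ?_⟩
  have hE : ((plus B).erase (some u)).erase (some v) = plus ((B.erase u).erase v) := by
    have h2 : Even ((B.erase u).erase v).card := by
      have hv2 : v ∈ B.erase u := Finset.mem_erase.mpr ⟨hvu, hvB⟩
      have := Finset.card_erase_add_one hv2
      rw [← Finset.card_erase_add_one hu, ← this, Nat.even_add_one, Nat.even_add_one, not_not]
        at heven
      exact heven
    rw [hplus, plus, if_pos h2, Finset.map_erase, Finset.map_erase]
    rfl
  rw [← det_submatrix_congr P.S hE]
  exact hv''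

/-! ### §2 One move: fixing the last condition by the new prime's adjacency to `b` -/

/-- **(i) Fixing `B ∪ {q}` core by `N b` when `B ∖ b` is core.** For `b ∈ B` with `B ∖ b` core and
ANY neighbourhood `N`, some value `t` of the new vertex's adjacency to `b` makes `B ∪ {q}` core in
`extend P (N[b ↦ t])`: by (SC2) with `X = oldV '' (B ∖ b)⁺`, `a = oldV b`, the condition reads
`N b + (Ŝ' κᵃ)_q = 1`, and `(Ŝ' κᵃ)_q` does not see `N b`. [folklore] -/
theorem exists_update_core_withNew (P : Position s) (N : V s → ZMod 2) {B : Finset (Fin s)}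
    {b : Fin s} (hb : b ∈ B) (hB₁ : Core P (B.erase b)) :
    ∃ t : ZMod 2, Core (extend P (Function.update N (some b) t)) (withNew B) := by
  classical
  set a : V (s + 1) := oldV (some b) with ha
  set q : V (s + 1) := some (Fin.last s) with hq
  set X : Finset (V (s + 1)) := (plus (B.erase b)).image oldV with hX
  have hmemX : ∀ {i}, i ∈ X → ∃ v ∈ plus (B.erase b), oldV v = i := fun hi =>
    Finset.mem_image.mp hi
  have haX : a ∉ X := by
    intro h
    obtain ⟨v, hv, hva⟩ := hmemX h
    have hvb : v = some b := Option.map_injective (Fin.castSucc_injective s) hva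
    subst hvb
    exact Finset.notMem_erase b B ((some_mem_plus_iff _ _).mp hv)
  have hqX : q ∉ X := by
    intro h
    obtain ⟨v, -, hv⟩ := hmemX h
    exact oldV_ne_new v hv
  have haq : a ≠ q := oldV_ne_new _
  have hXdet : ∀ N' : V s → ZMod 2,
      ((extend P N').S.submatrix (Subtype.val : ↥X → V (s + 1)) Subtype.val).det ≠ 0 := fun N' => by
    rw [hX, det_extend_image_oldV]
    exact (core_iff_det_ne_zero P _).mp hB₁
  obtain ⟨κa, hκaX, hκa⟩ :=
    Alt.exists_solution (extend P N).S X (hXdet N) (fun i => (extend P N).S i a)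
  set c₀ := ((extend P N).S *ᵥ κa) q with hc₀
  refine ⟨1 + c₀, ?_⟩
  set N' := Function.update N (some b) (1 + c₀) with hN'
  have hκa_a : κa a = 0 := hκaX a haX
  have hκa' : ∀ i ∈ X, ((extend P N').S *ᵥ κa) i = (extend P N').S i a := by
    intro i hi
    obtain ⟨v, hv, rfl⟩ := hmemX hi
    have hne : oldV v ≠ oldV (some b) := fun h => haX (by rw [ha, ← h]; exact hi)
    rw [hN', mulVec_extend_update P N _ hκa_a hne, hκa _ hi, ha, extend_S_oldV_oldV,
      extend_S_oldV_oldV]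
  obtain ⟨κq, hκqX, hκq⟩ :=
    Alt.exists_solution (extend P N').S X (hXdet N') (fun i => (extend P N').S i q)
  have key := Alt.det_insert_insert_eq_one_iff (extend P N').symm (extend P N').loopless haX hqX
    haq (hXdet N') hκaX hκa' hκqX hκq
  have hqa : (extend P N').S q a = 1 + c₀ := by
    rw [hq, ha, extend_S_new_oldV, hN', Function.update_self]
  have hκq_q : ((extend P N').S *ᵥ κa) q = c₀ := by
    rw [hN', mulVec_extend_update P N _ hκa_a (oldV_ne_new (some b)).symm]
  unfold Core
  rw [plus_withNew_eq_of_mem hb, Finset.insert_comm]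
  refine key.mpr ?_
  rw [hqa, hκq_q, add_assoc, CharTwo.add_self_eq_zero, add_zero]

/-! ### §3 Two moves with nothing to fix: the `(0,0)` case of lens-2's Step 4 -/

/-- **(ii) `B ∪ {q}` core is automatic.** Let `|B|` be even, `u ≠ v ∈ B` with `B`, `B ∖ {u,v}` core and
`B ∖ v`, `B ∖ u` NOT core. Then for every neighbourhood `N`: if `(B ∖ {u,v}) ∪ {q}` is core in
`extend P N`, so is `B ∪ {q}`. (With `X = oldV '' (B ∖ {u,v})⁺`: the hypotheses say
`σ_X(oldV u, ∞') = σ_X(oldV v, ∞') = 0`, so the solution `κ` of the column-`∞'` system on `X` also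
solves it on `X' = X ∪ {oldV u, oldV v} = oldV '' B⁺`, and (SC2) reads BOTH conditions as
`Ŝ'_{q∞'} + (Ŝ'κ)_q = 1`.) [folklore] -/
theorem core_withNew_of_pair (P : Position s) (N : V s → ZMod 2) {B : Finset (Fin s)} {u v : Fin s}
    (hu : u ∈ B) (hv : v ∈ B) (huv : u ≠ v) (heven : Even B.card) (hB : Core P B)
    (hB'' : Core P ((B.erase u).erase v)) (hBv : ¬ Core P (B.erase v)) (hBu : ¬ Core P (B.erase u))
    (hcond : Core (extend P N) (withNew ((B.erase u).erase v))) :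
    Core (extend P N) (withNew B) := by
  classical
  -- names
  set S' := (extend P N).S with hS'
  have hsym : S'.IsSymm := (extend P N).symm
  have hdg : ∀ i, S' i i = 0 := (extend P N).loopless
  set B'' := (B.erase u).erase v with hB''def
  set q : V (s + 1) := some (Fin.last s) with hq
  set p : V (s + 1) := oldV none with hp
  set u' : V (s + 1) := oldV (some u) with hu'
  set v' : V (s + 1) := oldV (some v) with hv'
  set X : Finset (V (s + 1)) := (plus B'').image oldV with hX
  have hinj : Function.Injective (oldV : V s → V (s + 1)) :=
    Option.map_injective (Fin.castSucc_injective s)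
  -- parities and the shape of the core sets
  have hvBu : v ∈ B.erase u := Finset.mem_erase.mpr ⟨huv.symm, hv⟩
  have huBv : u ∈ B.erase v := Finset.mem_erase.mpr ⟨huv, hu⟩
  have hcardB : B''.card + 2 = B.card := by
    rw [hB''def, ← Finset.card_erase_add_one hu, ← Finset.card_erase_add_one hvBu]
  have heven'' : Even B''.card := by
    rw [← hcardB, Nat.even_add] at heven
    exact heven.mpr (by decide)
  have hoddBv : ¬ Even (B.erase v).card := by
    have h := heven
    rw [← Finset.card_erase_add_one hv, Nat.even_add_one] at h
    exact h
  have hoddBu : ¬ Even (B.erase u).card := by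
    have h := heven
    rw [← Finset.card_erase_add_one hu, Nat.even_add_one] at h
    exact h
  have hplusB'' : plus B'' = B''.map Function.Embedding.some := if_pos heven''
  have hplusB : plus B = B.map Function.Embedding.some := if_pos heven
  have hBeq : B = insert u (insert v B'') := by
    rw [hB''def, Finset.insert_erase hvBu, Finset.insert_erase hu]
  -- X' = oldV '' B⁺ = X ∪ {u', v'}
  have hX' : (plus B).image oldV = insert u' (insert v' X) := by
    rw [hplusB, hX, hplusB'', hBeq, Finset.map_insert, Finset.map_insert, Finset.image_insert,
      Finset.image_insert]
    rfl
  -- membership facts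
  have hmemX : ∀ {i}, i ∈ X → ∃ w ∈ plus B'', oldV w = i := fun hi => Finset.mem_image.mp hi
  have hu'X : u' ∉ X := by
    intro h
    obtain ⟨w, hw, hwu⟩ := hmemX h
    have : w = some u := hinj hwu
    subst this
    have := (some_mem_plus_iff _ _).mp hw
    rw [hB''def, Finset.erase_right_comm] at this
    exact Finset.notMem_erase u _ this
  have hv'X : v' ∉ X := by
    intro h
    obtain ⟨w, hw, hwv⟩ := hmemX h
    have : w = some v := hinj hwv
    subst this
    exact Finset.notMem_erase v _ ((some_mem_plus_iff _ _).mp hw)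
  have hpX : p ∉ X := by
    intro h
    obtain ⟨w, hw, hwp⟩ := hmemX h
    have : w = none := hinj hwp
    subst this
    exact (none_mem_plus_iff B'').mp hw heven''
  have hqX : q ∉ X := by
    intro h
    obtain ⟨w, -, hw⟩ := hmemX h
    exact oldV_ne_new w hw
  have hpq : p ≠ q := oldV_ne_new _
  have hu'p : u' ≠ p := fun h => by cases hinj h
  have hv'p : v' ≠ p := fun h => by cases hinj h
  have hu'v' : u' ≠ v' := fun h => huv (by cases hinj h; rfl)
  have hpX' : p ∉ insert u' (insert v' X) := by simp [hu'p.symm, hv'p.symm, hpX]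
  have hqX' : q ∉ insert u' (insert v' X) := by
    simp only [Finset.mem_insert, not_or]
    exact ⟨(oldV_ne_new _).symm, (oldV_ne_new _).symm, hqX⟩
  -- the three minors of P, transported to S'
  have hXdet : (S'.submatrix (Subtype.val : ↥X → V (s + 1)) Subtype.val).det ≠ 0 := by
    rw [hS', hX, det_extend_image_oldV]
    exact (core_iff_det_ne_zero P _).mp hB''
  have hX'det : (S'.submatrix (Subtype.val : ↥(insert u' (insert v' X)) → V (s + 1))
      Subtype.val).det ≠ 0 := by
    rw [hS', ← hX', det_extend_image_oldV]
    exact (core_iff_det_ne_zero P _).mp hB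
  have hXu'det : (S'.submatrix (Subtype.val : ↥(insert u' (insert p X)) → V (s + 1))
      Subtype.val).det = 0 := by
    -- `B ∖ v = B'' ∪ {u}` is not core: `det Ŝ[∞ ∪ some '' (B ∖ v)] = 0`
    have hE : (plus (B.erase v)).image oldV = insert u' (insert p X) := by
      have : B.erase v = insert u B'' := by
        rw [hB''def, Finset.erase_right_comm, Finset.insert_erase]
        exact Finset.mem_erase.mpr ⟨huv, hu⟩
      rw [plus, if_neg hoddBv, this, Finset.map_insert, Finset.image_insert, Finset.image_insert,
        Finset.insert_comm, hX, hplusB'']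
      rfl
    have h0 : (P.S.submatrix (Subtype.val : ↥(plus (B.erase v)) → V s) Subtype.val).det = 0 := by
      by_contra h
      exact hBv ((core_iff_det_ne_zero P _).mpr h)
    rw [← det_extend_image_oldV P N, hE] at h0
    exact h0
  have hXv'det : (S'.submatrix (Subtype.val : ↥(insert v' (insert p X)) → V (s + 1))
      Subtype.val).det = 0 := by
    have hE : (plus (B.erase u)).image oldV = insert v' (insert p X) := by
      have : B.erase u = insert v B'' := by
        rw [hB''def, Finset.insert_erase hvBu]
      rw [plus, if_neg hoddBu, this, Finset.map_insert, Finset.image_insert, Finset.image_insert,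
        Finset.insert_comm, hX, hplusB'']
      rfl
    have h0 : (P.S.submatrix (Subtype.val : ↥(plus (B.erase u)) → V s) Subtype.val).det = 0 := by
      by_contra h
      exact hBu ((core_iff_det_ne_zero P _).mpr h)
    rw [← det_extend_image_oldV P N, hE] at h0
    exact h0
  -- solutions on X for the columns p, q, u', v'
  obtain ⟨κ, hκX, hκ⟩ := Alt.exists_solution S' X hXdet (fun i => S' i p)
  obtain ⟨κq, hκqX, hκq⟩ := Alt.exists_solution S' X hXdet (fun i => S' i q)
  obtain ⟨κu, hκuX, hκu⟩ := Alt.exists_solution S' X hXdet (fun i => S' i u')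
  obtain ⟨κv, hκvX, hκvu⟩ := Alt.exists_solution S' X hXdet (fun i => S' i v')
  -- (1) the condition two levels down: `σ_X(p, q) = 1`
  have hβ : S' q p + (S' *ᵥ κ) q = 1 := by
    have key := Alt.det_insert_insert_eq_one_iff hsym hdg hpX hqX hpq hXdet hκX hκ hκqX hκq
    refine key.mp ?_
    have h := hcond
    unfold Core at h
    rw [plus_withNew_eq_of_even heven'', Finset.insert_comm] at h
    exact h
  -- (2) `σ_X(u', p) = 0` and `σ_X(v', p) = 0`, in the form `(S' κ) u' = S' u' p`
  have hκu' : (S' *ᵥ κ) u' = S' u' p := by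
    have key := Alt.det_insert_insert_eq_zero_iff hsym hdg hu'X hpX hu'p hXdet hκuX hκu hκX hκ
    have h0 : S' p u' + (S' *ᵥ κu) p = 0 := key.mp hXu'det
    rw [Alt.schur_symm hsym hκuX hκu hκX hκ] at h0
    -- h0 : S' u' p + (S' *ᵥ κ) u' = 0
    rw [← CharTwo.sub_eq_add, sub_eq_zero] at h0
    exact h0.symm
  have hκv' : (S' *ᵥ κ) v' = S' v' p := by
    have key := Alt.det_insert_insert_eq_zero_iff hsym hdg hv'X hpX hv'p hXdet hκvX hκvu hκX hκ
    have h0 : S' p v' + (S' *ᵥ κv) p = 0 := key.mp hXv'det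
    rw [Alt.schur_symm hsym hκvX hκvu hκX hκ] at h0
    rw [← CharTwo.sub_eq_add, sub_eq_zero] at h0
    exact h0.symm
  -- (3) hence κ solves the column-p system on X' = X ∪ {u', v'}
  have hκX' : ∀ i, i ∉ insert u' (insert v' X) → κ i = 0 := fun i hi => by
    simp only [Finset.mem_insert, not_or] at hi
    exact hκX i hi.2.2
  have hκ' : ∀ i ∈ insert u' (insert v' X), (S' *ᵥ κ) i = S' i p := by
    intro i hi
    rcases Finset.mem_insert.mp hi with rfl | hi
    · exact hκu'
    rcases Finset.mem_insert.mp hi with rfl | hi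
    · exact hκv'
    · exact hκ i hi
  obtain ⟨κq', hκq'X, hκq'⟩ :=
    Alt.exists_solution S' (insert u' (insert v' X)) hX'det (fun i => S' i q)
  -- (4) the last condition, read through the SAME β
  have key' := Alt.det_insert_insert_eq_one_iff hsym hdg hpX' hqX' hpq hX'det hκX' hκ' hκq'X hκq'
  unfold Core
  rw [plus_withNew_eq_of_even heven, hX', Finset.insert_comm]
  exact key'.mpr hβ

end Summit.BirchSwinnertonDyer.Rank1Residual.X5.SelmerSolitaire
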